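import Mathlib
import Summits.ResolutionOfSingularities.ResolutionOfSingularities.Theorems.WildQuotientsWildQuotientResolutionCyclicTransferAlgebra
import Summits.ResolutionOfSingularities.ResolutionOfSingularities.Theorems.WildQuotientsKiralyLutkebohmertConjectureNineThreeFull
import HarnessLib

/-!
# Cyclic transfer, CONVERSE at a totally ramified prime for `p ∈ {2, 3}`: a regular quotient forces
# a principal augmentation ideal (Király–Lütkebohmert's Conjecture 9, localised)

Route `ResolutionOfSingularities/WildQuotients`; helper toward the kill criterion of the crux
`CyclicQuotientFourfolds` (stmt-ResolutionOfSingularities-17941, research stub `stub_reachLowerInFX`,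
finding F10 «typed tightness needs GOOD ⇒ PRINCIPAL ⊇ Király–Lütkebohmert's conjecture»). The tree's
cyclic transfer (`CyclicTransfer.isRegularRing_eqLocus`, crux 15640) proves: augmentation ideal
principal at every `σ`-fixed prime `𝔮` (`hdiv`) ⇒ `B^σ` regular. This file proves the CONVERSE at a
fixed prime when the order is `2` or `3`, in the same currency:

* `CyclicTransfer.moduleFinite_locFixed` — `B_𝔮` is module-finite over the fixed ring of the
  induced automorphism `σ'` when `B` is module-finite over `B^σ` (norm trick: `b/t = (ub)/N(t)`).
* `CyclicTransfer.isPrincipal_map_augIdeal_of_isRegularLocalRing` — for a domain `B`, `σ ≠ 1` of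
  prime order `p ∈ {2, 3}`, `B` module-finite over `A = B^σ`, and a `σ`-stable prime `𝔮` with
  `B_𝔮` regular: if `A_{𝔮 ∩ A}` is regular then the augmentation ideal `(σ b − b : b)` becomes
  principal in `B_𝔮` — by `A_{𝔮∩A} ≅ (B_𝔮)^{σ'}` (`stub_locFixed`) and Király–Lütkebohmert's
  Conjecture 9 for `p = 2, 3` (`kl_conjecture9_two`, `kl_conjecture9_three`).
  [cite: KiralyLutkebohmert2013, §3 Conjecture 9 (cases p = 2, 3), pp. 70–71]

[OURS · crux stmt-ResolutionOfSingularities-17941 · helper (def-free); counted 0; AI-level work,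
weaker than expert review.]
-/

set_option linter.dupNamespace false

noncomputable section

open IsLocalRing

namespace Summit.ResolutionOfSingularities.ResolutionOfSingularities.Theorems.WildQuotientResolution.CyclicTransfer

/-- **`B_𝔮` is module-finite over the fixed ring of `σ'`** (`σ'` an automorphism of `B_𝔮`
compatible with `σ`, `𝔮` a `σ`-stable prime, `σ ^ p = 1` with `p` prime, `B` a domain
module-finite over `B^σ`): every fraction is `(u b) / N(t)` with `N(t)` invariant, and `u b` is an
`A`-combination of finitely many generators. [folklore; Bourbaki AC V §1 no. 9] -/
theorem moduleFinite_locFixed {B : Type} [CommRing B] [IsDomain B] {p : ℕ} (hp : p.Prime)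
    (σ : B ≃+* B) (hσp : σ ^ p = RingEquiv.refl B)
    [Module.Finite ((σ : B →+* B).eqLocus (RingHom.id B)) B]
    (𝔮 : Ideal B) [𝔮.IsPrime] (h𝔮 : 𝔮.comap σ = 𝔮)
    (σ' : Localization.AtPrime 𝔮 ≃+* Localization.AtPrime 𝔮)
    (hσ' : ∀ b : B, σ' (algebraMap B (Localization.AtPrime 𝔮) b) =
      algebraMap B (Localization.AtPrime 𝔮) (σ b)) :
    Module.Finite ((σ' : Localization.AtPrime 𝔮 →+* Localization.AtPrime 𝔮).eqLocus (RingHom.id _))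
      (Localization.AtPrime 𝔮) := by
  classical
  set L := Localization.AtPrime 𝔮
  set A : Subring B := (σ : B →+* B).eqLocus (RingHom.id B) with hA
  set A' : Subring L := (σ' : L →+* L).eqLocus (RingHom.id L) with hA'
  obtain ⟨n, rfl⟩ : ∃ n, p = n + 1 := ⟨p - 1, (Nat.sub_add_cancel hp.one_lt.le).symm⟩
  have hσ1 : σ ^ (n + 1) = 1 := hσp
  obtain ⟨S, hS⟩ := Module.finite_def.mp (inferInstance : Module.Finite A B)
  -- images of elements of `A` and of `A`-combinations of `S` lie in the `A'`-span of the image of `S`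
  have hAfix : ∀ a : A, σ' (algebraMap B L a) = algebraMap B L a := fun a => by
    rw [hσ']; exact congrArg _ a.2
  have hspan : ∀ y ∈ Submodule.span A (S : Set B),
      algebraMap B L y ∈ Submodule.span A' ((S.image (algebraMap B L) : Finset L) : Set L) := by
    intro y hy
    induction hy using Submodule.span_induction with
    | mem s hs =>
      exact Submodule.subset_span (by simpa using Finset.mem_image_of_mem (algebraMap B L) hs)
    | zero => simp
    | add x y _ _ hx hy => rw [map_add]; exact add_mem hx hy
    | smul a x _ hx =>
      have e : algebraMap B L (a • x) = (⟨algebraMap B L a, hAfix a⟩ : A') • algebraMap B L x := by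
        rw [Subring.smul_def, Subring.smul_def, smul_eq_mul, map_mul, smul_eq_mul]
      rw [e]
      exact Submodule.smul_mem _ _ hx
  refine Module.finite_def.mpr ⟨S.image (algebraMap B L), ?_⟩
  rw [eq_top_iff]
  rintro x -
  obtain ⟨⟨b, t⟩, rfl⟩ := IsLocalization.mk'_surjective 𝔮.primeCompl x
  -- invariant denominator
  obtain ⟨u, hu⟩ : ∃ u : B, (∏ i ∈ Finset.range n, (σ ^ (i + 1)) (t : B)) = u := ⟨_, rfl⟩
  have hN : σ (u * t) = u * t := by
    rw [← hu, ← locFixed_norm_eq]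
    exact locFixed_apply_norm σ hσ1 t
  have hu𝔮 : u ∉ 𝔮 := by
    rw [← hu]
    exact locFixed_prod_pow_apply_notMem σ 𝔮 h𝔮 t.2 _ _
  have hut : u * t ∉ 𝔮 := ‹𝔮.IsPrime›.mul_notMem hu𝔮 t.2
  set tt : 𝔮.primeCompl := ⟨u * t, hut⟩ with htt
  have e1 : IsLocalization.mk' L b t = IsLocalization.mk' L (u * b) tt :=
    IsLocalization.mk'_eq_of_eq (by show (t : B) * (u * b) = u * t * b; ring)
  have hw : σ' (IsLocalization.mk' L (1 : B) tt) = IsLocalization.mk' L (1 : B) tt :=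
    locFixed_apply_mk' σ 𝔮 σ' hσ' (map_one σ) hN
  have e2 : IsLocalization.mk' L (u * b) tt =
      (⟨IsLocalization.mk' L (1 : B) tt, hw⟩ : A') • algebraMap B L (u * b) := by
    rw [Subring.smul_def, smul_eq_mul]
    exact (IsLocalization.mk'_eq_mul_mk'_one (S := L) (u * b) tt).trans (mul_comm _ _)
  show IsLocalization.mk' L b t ∈ _
  rw [e1, e2]
  refine Submodule.smul_mem _ _ (hspan _ ?_)
  rw [hS]
  exact Submodule.mem_top

/-- **Converse of the cyclic transfer at a totally ramified prime, `p ∈ {2, 3}`**: `B` a domain,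
`σ ≠ 1` with `σ ^ p = 1`, `B` module-finite over `A = B^σ`, `𝔮` a `σ`-stable prime with `B_𝔮`
regular. If `A_{𝔮 ∩ A}` is regular, then the augmentation ideal `(σ b − b : b ∈ B)` becomes
principal in `B_𝔮` — Király–Lütkebohmert's Conjecture 9 (cases `p = 2, 3`, tree theorems
`kl_conjecture9_two` / `kl_conjecture9_three`) transported along `A_{𝔮∩A} ≅ (B_𝔮)^{σ'}`
(`stub_locFixed`). [cite: KiralyLutkebohmert2013, §3 Conjecture 9 (cases p = 2, 3), pp. 70–71] -/
theorem isPrincipal_map_augIdeal_of_isRegularLocalRing {B : Type} [CommRing B] [IsDomain B]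
    {p : ℕ} (hp : p.Prime) (hp23 : p = 2 ∨ p = 3)
    (σ : B ≃+* B) (hσ1 : σ ≠ RingEquiv.refl B) (hσp : σ ^ p = RingEquiv.refl B)
    [Module.Finite ((σ : B →+* B).eqLocus (RingHom.id B)) B]
    (𝔮 : Ideal B) [𝔮.IsPrime] (hfix : 𝔮.comap σ = 𝔮)
    [IsRegularLocalRing (Localization.AtPrime 𝔮)]
    [IsRegularLocalRing
      (Localization.AtPrime (𝔮.comap ((σ : B →+* B).eqLocus (RingHom.id B)).subtype))] :
    ((Ideal.span (Set.range fun b : B => σ b - b)).map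
      (algebraMap B (Localization.AtPrime 𝔮))).IsPrincipal := by
  classical
  set L := Localization.AtPrime 𝔮
  -- the induced automorphism `σ'` of `B_𝔮`
  have key : ∀ y : B, y ∈ 𝔮 ↔ σ y ∈ 𝔮 := fun y => by
    conv_lhs => rw [← hfix]
    exact Ideal.mem_comap
  have hS : 𝔮.primeCompl.map σ.toMonoidHom = 𝔮.primeCompl := by
    apply le_antisymm
    · rintro _ ⟨y, hy, rfl⟩
      exact Ideal.mem_primeCompl_iff.mpr fun hx => Ideal.mem_primeCompl_iff.mp hy ((key y).mpr hx)
    · intro x hx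
      refine ⟨σ.symm x, Ideal.mem_primeCompl_iff.mpr fun h => Ideal.mem_primeCompl_iff.mp hx ?_,
        σ.apply_symm_apply x⟩
      simpa only [σ.apply_symm_apply] using (key (σ.symm x)).mp h
  let σ' : L ≃+* L := IsLocalization.ringEquivOfRingEquiv L L σ hS
  have hσ' : ∀ b : B, σ' (algebraMap B L b) = algebraMap B L (σ b) := fun b =>
    IsLocalization.ringEquivOfRingEquiv_eq hS b
  -- `σ' ≠ 1`, `σ' ^ p = 1`
  have hσ'1 : σ' ≠ 1 := by
    intro h
    apply hσ1
    ext b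
    have h1 := hσ' b
    rw [h, RingAut.one_apply] at h1
    exact (IsLocalization.injective L 𝔮.primeCompl_le_nonZeroDivisors h1).symm
  have hσ'p : σ' ^ p = 1 := by
    have k : ((σ' ^ p : L ≃+* L) : L →+* L) = ((RingEquiv.refl L : L ≃+* L) : L →+* L) := by
      refine IsLocalization.ringHom_ext 𝔮.primeCompl ?_
      ext b
      simp only [RingHom.coe_comp, RingHom.coe_coe, Function.comp_apply, RingEquiv.refl_apply]
      rw [locAut_pow_algebraMap σ σ' hσ' p b, hσp, RingEquiv.refl_apply]
    exact RingEquiv.ext fun x => RingHom.congr_fun k x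
  -- `A_𝔭 ≅ (B_𝔮)^{σ'}`, hence the fixed ring of `σ'` is regular
  obtain ⟨hinj, hrange⟩ := stub_locFixed hp σ hσp 𝔮 hfix σ' hσ'
  set φ := Localization.localRingHom (𝔮.comap ((σ : B →+* B).eqLocus (RingHom.id B)).subtype) 𝔮
    ((σ : B →+* B).eqLocus (RingHom.id B)).subtype rfl with hφ
  have hbij : Function.Bijective φ.rangeRestrict :=
    ⟨fun x y h => hinj (congrArg Subtype.val h), φ.rangeRestrict_surjective⟩
  let e : Localization.AtPrime (𝔮.comap ((σ : B →+* B).eqLocus (RingHom.id B)).subtype) ≃+*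
      (σ' : L →+* L).eqLocus (RingHom.id L) :=
    (RingEquiv.ofBijective φ.rangeRestrict hbij).trans (RingEquiv.subringCongr hrange)
  haveI : IsRegularLocalRing ((σ' : L →+* L).eqLocus (RingHom.id L)) :=
    IsRegularLocalRing.of_ringEquiv e
  haveI : Module.Finite ((σ' : L →+* L).eqLocus (RingHom.id L)) L :=
    moduleFinite_locFixed hp σ hσp 𝔮 hfix σ' hσ'
  -- Conjecture 9 for `σ'`
  have hconj : (Ideal.span (Set.range fun x : L => σ' x - x)).IsPrincipal := by
    rcases hp23 with rfl | rfl
    · exact kl_conjecture9_two σ' hσ'p hσ'1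
    · exact kl_conjecture9_three σ' hσ'p hσ'1
  rw [← augIdeal_locAut_eq_map σ 𝔮 σ' hσ']
  exact hconj


/-- **The cyclic transfer is an EQUIVALENCE for `p ∈ {2, 3}`**: for a regular domain `B`, a ring
automorphism `σ ≠ 1` of prime order `p ∈ {2, 3}` with `B` module-finite over the Noetherian fixed
ring `A = B^σ`: `A` is a regular ring iff at every `σ`-stable prime `𝔮` of `B` the augmentation
ideal `(σ b − b : b ∈ B)` becomes principal in `B_𝔮` (the Király–Lütkebohmert terminal state).
`⇐` is the tree's `isRegularRing_eqLocus` (any prime `p`); `⇒` is Conjecture 9 for `p = 2, 3`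
prime by prime (`isPrincipal_map_augIdeal_of_isRegularLocalRing`).
[cite: KiralyLutkebohmert2013, Thm. 2 and §3 Conjecture 9 (cases p = 2, 3)] -/
theorem isRegularRing_eqLocus_iff_hdiv {B : Type} [CommRing B] [IsDomain B] [IsRegularRing B]
    {p : ℕ} (hp : p.Prime) (hp23 : p = 2 ∨ p = 3)
    (σ : B ≃+* B) (hσ1 : σ ≠ RingEquiv.refl B) (hσp : σ ^ p = RingEquiv.refl B)
    [IsNoetherianRing ((σ : B →+* B).eqLocus (RingHom.id B))]
    [Module.Finite ((σ : B →+* B).eqLocus (RingHom.id B)) B] :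
    IsRegularRing ((σ : B →+* B).eqLocus (RingHom.id B)) ↔
      ∀ (𝔮 : Ideal B) [𝔮.IsPrime], 𝔮.comap σ = 𝔮 →
        ((Ideal.span (Set.range fun b : B => σ b - b)).map
          (algebraMap B (Localization.AtPrime 𝔮))).IsPrincipal := by
  constructor
  · intro hA 𝔮 _ hfix
    haveI : IsRegularLocalRing (Localization.AtPrime 𝔮) :=
      IsRegularRing.isRegularLocalRing_localization 𝔮
    haveI : IsRegularLocalRing
        (Localization.AtPrime (𝔮.comap ((σ : B →+* B).eqLocus (RingHom.id B)).subtype)) :=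
      IsRegularRing.isRegularLocalRing_localization _
    exact isPrincipal_map_augIdeal_of_isRegularLocalRing hp hp23 σ hσ1 hσp 𝔮 hfix
  · intro hdiv
    exact isRegularRing_eqLocus hp σ hσ1 hσp (fun 𝔮 _ h => hdiv 𝔮 h)

end Summit.ResolutionOfSingularities.ResolutionOfSingularities.Theorems.WildQuotientResolution.CyclicTransfer

end
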